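import Literature.NumberTheory.EllipticCurves.KubertTateThirteen
import HarnessLib

/-!
# The raw plane model of `X₁(9)` in Tate normal form: Kubert's one-parameter family of the curves
# with a point of order `9`

Topic `NumberTheory/EllipticCurves`; continues `Literature.NumberTheory.EllipticCurves.KubertTateNormalForm`
(the Tate normal form `E(b, c) : y² + (1 - c)xy - by = x³ - bx²` with marked point `P = (0, 0)`,
`2P = (b, bc)`, `3P = (c, b - c)`, Knapp §V.5 (5.30)) and
`Literature.NumberTheory.EllipticCurves.KubertTateThirteen` (Sutherland's chart `b = rs(r - 1)`,
`c = s(r - 1)`, `r = b/c`, `s = c²/(b - c)`, and the proved multiples `4P = (r(r - 1), r²(r - 1)(s - 1))`,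
`5P = (rs(s - 1), rs²(r - s))`). THEOREMS ONLY (no definition, no named fact, no `sorry`): the
polynomials are written out in the statements.

The case `N = 9` of Kubert's table (Kubert 1976, Table 3; Sutherland 2012 §2, "`NP = 0_E ⟺ x_m = x_n`"
with `m = 5`, `n = 4`): `9P = 𝒪` iff `5P = -4P` iff `x(5P) = x(4P)` iff `rs(s - 1) = r(r - 1)` iff
**`r = s² - s + 1`** — the RAW MODEL OF `X₁(9)` (a rational curve, parameter `s`); in the `(b, c)`-plane
this is `X₉(b, c) := (b - c)³ + bc³ - c⁴ - c⁵ = 0` (`X₉(rs(r-1), s(r-1)) = s³(r - 1)⁵ (r - s² + s - 1)`,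
`kubertTateX₉_eq_mul_raw`), and solving for `(b, c)` along `r = s² - s + 1` gives KUBERT'S FAMILY

  `b = f²(f - 1)(f² - f + 1)`, `c = f²(f - 1)`  (`f = s`; Kubert's `(b, c) = (cd, fd - f)`, `d = f² - f + 1`).

* `kubertTate_nine_nsmul_zero_iff` — on `E(rs(r-1), s(r-1))` with `r ∉ {0, 1}`, `s ≠ 0`:
  `9 · (0,0) = 𝒪 ⟺ r = s² - s + 1`;
* **`kubertTate_addOrderOf_zero_eq_nine_iff`** — over any field, for `b ≠ 0` (no condition on `Δ`):
  `addOrderOf (0,0) = 9 ⟺ (b - c)³ + bc³ - c⁴ - c⁵ = 0` (`⟹`: order `9` forces `c ≠ 0`, `b ≠ c`, then the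
  chart; `⟸`: `X₉(b, 0) = b³`, `X₉(b, b) = -b⁵` force `c ≠ 0`, `b ≠ c`; `9P = 𝒪` and `3P = (c, b - c) ≠ 𝒪`
  give order exactly `9`); `(r, s)` form `kubertTate_addOrderOf_zero_eq_nine_iff_raw`;
* `kubertTate_nine_family_addOrderOf_eq_nine` — on `E(f²(f-1)(f²-f+1), f²(f-1))` with `f ∉ {0, 1}`,
  `f² - f + 1 ≠ 0` (`⟺ b ≠ 0`, `kubertTate_nine_family_nonsingular_zero_iff`) the point `(0, 0)` has order
  EXACTLY `9` (the identity `X₉(b(f), c(f)) = 0`, `kubertTateX₉_nine_family`);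
* **`exists_kubertTate_nine_of_addOrderOf_eq_nine`** — over any field `F`: a Weierstrass curve with a
  nonsingular `F`-point of order `9` is carried by an admissible change of variables onto
  `E(f²(f-1)(f²-f+1), f²(f-1))` for some `f ∈ F`, `f ∉ {0, 1}`, `f² - f + 1 ≠ 0` (Tate normal form by the
  tree's `exists_variableChange_pointEquiv_eq_zero`, then the raw model); with the converse,
  **`exists_addOrderOf_eq_nine_iff_exists_kubertTate_nine`**: "`W` has an `F`-point of order `9`" ⟺
  "`W ≅ E₉(f)` for some admissible `f`". No ellipticity hypothesis is needed (for singular `E(b, c)` the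
  group is that of the nonsingular points).

Over `ℚ` this is the universal family of the rational `9`-torsion curves (`X₁(9) ≅ ℙ¹`; e.g. `f = 2`:
`E(12, 4)`, `f = -1`: `E(-6, -2)`), the object behind the `ℤ/9`-member disjunct of the BSD cell's O6 crux
(`Summits/…/Theorems/KatoDescentPotSupersingularWildUpperReducibleNineTorsionStructure.lean`).

## References

* [Kubert1976] D. S. Kubert, *Universal bounds on the torsion of elliptic curves*, Proc. London Math. Soc.
  (3) 33 (1976) 193–237, Table 3 (`N = 9`: `b = cd`, `c = fd - f`, `d = f(f - 1) + 1`).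
* [Sutherland2012] A. V. Sutherland, *Constructing elliptic curves over finite fields with prescribed
  torsion*, Math. Comp. 81 (2012) 1131–1147, §2 (raw form of `X₁(N)`: `x_n = x_m`; `x₄ = r(r - 1)`,
  `x₅ = rs(s - 1)`).
* [Knapp1993] A. W. Knapp, *Elliptic Curves*, §V.5 pp. 146–147 (Tate normal form, (5.30)).
-/

noncomputable section

open scoped Classical

namespace WeierstrassCurve

/-! ### The polynomial identity behind the raw model of `X₁(9)` -/

section Ring

variable {R : Type*} [CommRing R]

/-- **The raw model of `X₁(9)` in Sutherland's chart**: `X₉(rs(r-1), s(r-1)) = s³(r - 1)⁵·(r - (s² - s + 1))` for the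
polynomial `X₉(b, c) = (b - c)³ + bc³ - c⁴ - c⁵`. [cite: Sutherland2012, §2 (raw form of X₁(N), N = 9)] -/
theorem kubertTateX₉_eq_mul_raw (r s : R) :
    (r * s * (r - 1) - s * (r - 1)) ^ 3 + r * s * (r - 1) * (s * (r - 1)) ^ 3 -
        (s * (r - 1)) ^ 4 - (s * (r - 1)) ^ 5 =
      s ^ 3 * (r - 1) ^ 5 * (r - (s ^ 2 - s + 1)) := by
  ring

/-- `X₉(b, 0) = b³` (the excluded value `c = 0`: there `3P = -P`). [folklore] -/
private theorem kubertTateX₉_zero_right (b : R) :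
    (b - 0) ^ 3 + b * (0 : R) ^ 3 - (0 : R) ^ 4 - (0 : R) ^ 5 = b ^ 3 := by
  ring

/-- `X₉(b, b) = -b⁵` (the excluded value `b = c`: there `3P = -2P`). [folklore] -/
private theorem kubertTateX₉_self_self (b : R) :
    (b - b) ^ 3 + b * b ^ 3 - b ^ 4 - b ^ 5 = -b ^ 5 := by
  ring

/-- **Kubert's family lies on the raw model**: `X₉(f²(f-1)(f²-f+1), f²(f-1)) = 0` identically.
[cite: Kubert1976, Table 3 (N = 9: b = cd, c = fd − f, d = f(f−1)+1)] -/
theorem kubertTateX₉_nine_family (f : R) :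
    (f ^ 2 * (f - 1) * (f ^ 2 - f + 1) - f ^ 2 * (f - 1)) ^ 3 +
        f ^ 2 * (f - 1) * (f ^ 2 - f + 1) * (f ^ 2 * (f - 1)) ^ 3 -
        (f ^ 2 * (f - 1)) ^ 4 - (f ^ 2 * (f - 1)) ^ 5 = 0 := by
  ring

end Ring

section Field

variable {F : Type*} [Field F] [DecidableEq F]

omit [DecidableEq F] in
/-- Transport of an affine point along equalities of its coordinates. [folklore] -/
private theorem some_eq_some_of_coord_eq {W : WeierstrassCurve F} {x y x' y' : F}
    (h : W.toAffine.Nonsingular x y) (hx : x = x') (hy : y = y') :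
    ∃ h', (Affine.Point.some x y h : W.toAffine.Point) = Affine.Point.some x' y' h' := by
  subst hx hy
  exact ⟨h, rfl⟩

omit [DecidableEq F] in
/-- In an additive group, `(k+1)·P = ±P` forces `k·P = 0` or `(k+2)·P = 0`. [folklore] -/
private theorem nsmul_eq_zero_or_of_eq_or_eq_neg {A : Type*} [AddGroup A] (P : A) (k : ℕ)
    (h : (k + 1) • P = P ∨ (k + 1) • P = -P) : k • P = 0 ∨ (k + 2) • P = 0 := by
  rcases h with h | h
  · left
    rwa [succ_nsmul, add_eq_right] at h
  · right
    rw [succ_nsmul] at h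
    rw [show k + 2 = k + 1 + 1 from rfl, succ_nsmul, succ_nsmul, h, neg_add_cancel]

variable (r s : F)

/-- **`9 · (0,0) = 𝒪 ⟺ r = s² - s + 1`** on `E(rs(r-1), s(r-1))` with `r ∉ {0, 1}`, `s ≠ 0` (the open part where
`b ≠ 0` and `4P`, `5P` have the displayed coordinates): `9P = 5P + 4P = 𝒪` iff `5P = -4P` iff `x(5P) = x(4P)`
(the alternative `5P = 4P` would give `P = 𝒪`), i.e. iff `rs(s - 1) = r(r - 1)`.
[cite: Sutherland2012, §2 ("NP = 0_E ⟺ x_m = x_n", N = 9, m = 5, n = 4)] -/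
theorem kubertTate_nine_nsmul_zero_iff
    (h₀ : (kubertTate (r * s * (r - 1)) (s * (r - 1))).toAffine.Nonsingular 0 0)
    (hr : r ≠ 0) (hr₁ : r ≠ 1) (hs : s ≠ 0) :
    9 • (Affine.Point.some 0 0 h₀ : (kubertTate (r * s * (r - 1)) (s * (r - 1))).toAffine.Point)
      = 0 ↔ r = s ^ 2 - s + 1 := by
  obtain ⟨h₄, e₄⟩ := kubertTate_four_nsmul_zero r s h₀ hr₁ hs
  obtain ⟨h₅, e₅⟩ := kubertTate_five_nsmul_zero r s h₀ hr hr₁ hs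
  have e9 : 9 • (Affine.Point.some 0 0 h₀ :
      (kubertTate (r * s * (r - 1)) (s * (r - 1))).toAffine.Point)
      = 5 • Affine.Point.some 0 0 h₀ + 4 • Affine.Point.some 0 0 h₀ := by
    rw [show (9 : ℕ) = 5 + 4 from rfl, add_nsmul]
  constructor
  · intro h
    rw [e9] at h
    have h' := eq_neg_of_add_eq_zero_left h
    rw [e₄, e₅, Affine.Point.neg_some, Affine.Point.some.injEq] at h'
    have hx : r * s * (s - 1) = r * (r - 1) := h'.1
    have hx' : r * (s * (s - 1) - (r - 1)) = 0 := by linear_combination hx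
    rcases mul_eq_zero.mp hx' with h0 | h0
    · exact absurd h0 hr
    · linear_combination -h0
  · intro hF
    have hx : r * s * (s - 1) = r * (r - 1) := by rw [hF]; ring
    obtain ⟨h₅', e₅'⟩ := some_eq_some_of_coord_eq h₅ (x' := r * (r - 1))
      (y' := r * s ^ 2 * (r - s)) hx rfl
    rw [e₅'] at e₅
    rcases (Affine.Point.X_eq_iff (h₁ := h₅') (h₂ := h₄)).mp rfl with h | h
    · exfalso
      rw [← e₅, ← e₄, succ_nsmul, add_eq_left] at h
      exact Affine.Point.some_ne_zero h₀ h
    · rw [e9, e₅, e₄, h, neg_add_cancel]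

variable (b c : F)

/-- **The raw plane model of `X₁(9)`, proved**: over any field, for `b c` with `(0, 0)` a nonsingular point of
`E(b, c)` (i.e. `b ≠ 0`; `Δ(b, c)` may vanish), `(0, 0)` has order exactly `9` iff
`(b - c)³ + bc³ - c⁴ - c⁵ = 0`. (`⟹`: order `9` gives `c ≠ 0` (`x(3P) ≠ x(P)`), `b ≠ c` (`x(3P) ≠ x(2P)`), then
in the `(r, s)` chart `kubertTate_nine_nsmul_zero_iff` gives `r = s² - s + 1`, whence `X₉ = s³(r-1)⁵·0 = 0`.
`⟸`: `X₉(b, 0) = b³`, `X₉(b, b) = -b⁵` force `c ≠ 0`, `b ≠ c`; in the chart `r = s² - s + 1`, so `9P = 𝒪`,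
and `3P = (c, b - c) ≠ 𝒪`, so the order is `9` (`addOrderOf_eq_prime_pow`).)
[cite: Sutherland2012, §2 (defining equation of X₁(N) in E(b,c)-coordinates, any field), N = 9] [cite: Kubert1976, Table 3] -/
theorem kubertTate_addOrderOf_zero_eq_nine_iff
    (h₀ : (kubertTate b c).toAffine.Nonsingular 0 0) :
    addOrderOf (Affine.Point.some 0 0 h₀ : (kubertTate b c).toAffine.Point) = 9 ↔
      (b - c) ^ 3 + b * c ^ 3 - c ^ 4 - c ^ 5 = 0 := by
  have hb : b ≠ 0 := (kubertTate_nonsingular_zero_iff b c).mp h₀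
  set P₀ : (kubertTate b c).toAffine.Point := Affine.Point.some 0 0 h₀ with hP₀
  have e2 := kubertTate_two_nsmul_zero b c h₀
  have e3 := kubertTate_three_nsmul_zero b c h₀
  haveI : Fact (Nat.Prime 3) := ⟨Nat.prime_three⟩
  constructor
  · intro h9
    have hdvd : ∀ k : ℕ, k • P₀ = 0 → 9 ∣ k := fun k hk =>
      h9 ▸ addOrderOf_dvd_of_nsmul_eq_zero hk
    -- `c ≠ 0`, else `x(3P) = x(P)`
    have hc : c ≠ 0 := by
      intro hc
      rcases nsmul_eq_zero_or_of_eq_or_eq_neg P₀ 2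
        (by rw [hP₀, e3]; exact (Affine.Point.X_eq_iff (h₂ := h₀)).mp hc) with h | h
      · exact absurd (hdvd 2 h) (by norm_num)
      · exact absurd (hdvd 4 h) (by norm_num)
    -- `b ≠ c`, else `x(3P) = x(2P)`
    have hbc : b - c ≠ 0 := by
      intro hbc
      rcases (Affine.Point.X_eq_iff
        (h₁ := kubertTate_nonsingular_three b c hb)
        (h₂ := kubertTate_nonsingular_two b c hb)).mp (sub_eq_zero.mp hbc).symm with h | h
      · rw [← e2, ← e3, succ_nsmul, add_eq_left] at h
        exact Affine.Point.some_ne_zero h₀ h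
      · have h5 : 5 • P₀ = 0 := by
          rw [show (5 : ℕ) = 3 + 2 from rfl, add_nsmul, hP₀, e3, e2, h, neg_add_cancel]
        exact absurd (hdvd 5 h5) (by norm_num)
    -- pass to `(r, s)`
    obtain ⟨r, s, rfl, rfl⟩ := exists_kubertTate_param b c hc hbc
    have hs : s ≠ 0 := left_ne_zero_of_mul hc
    have hr₁' : r - 1 ≠ 0 := right_ne_zero_of_mul hc
    have hr₁ : r ≠ 1 := sub_ne_zero.mp hr₁'
    have hr : r ≠ 0 := by
      intro h
      apply hb
      rw [h]
      ring
    have h9' : 9 • P₀ = 0 := addOrderOf_dvd_iff_nsmul_eq_zero.mp (h9 ▸ dvd_refl _)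
    rw [kubertTateX₉_eq_mul_raw, (kubertTate_nine_nsmul_zero_iff r s h₀ hr hr₁ hs).mp h9']
    ring
  · intro hX
    have hc : c ≠ 0 := by
      intro hc
      rw [hc, kubertTateX₉_zero_right] at hX
      exact hb (pow_eq_zero_iff (n := 3) (by norm_num) |>.mp hX)
    have hbc : b - c ≠ 0 := by
      intro hbc
      rw [(sub_eq_zero.mp hbc).symm, kubertTateX₉_self_self, neg_eq_zero] at hX
      exact hb (pow_eq_zero_iff (n := 5) (by norm_num) |>.mp hX)
    obtain ⟨r, s, rfl, rfl⟩ := exists_kubertTate_param b c hc hbc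
    have hs : s ≠ 0 := left_ne_zero_of_mul hc
    have hr₁' : r - 1 ≠ 0 := right_ne_zero_of_mul hc
    have hr₁ : r ≠ 1 := sub_ne_zero.mp hr₁'
    have hr : r ≠ 0 := by
      intro h
      apply hb
      rw [h]
      ring
    rw [kubertTateX₉_eq_mul_raw] at hX
    have hF : r = s ^ 2 - s + 1 := by
      rcases mul_eq_zero.mp hX with h | h
      · exact absurd h (mul_ne_zero (pow_ne_zero 3 hs) (pow_ne_zero 5 hr₁'))
      · linear_combination h
    have h9 : 3 ^ (1 + 1) • P₀ = 0 := by
      rw [show 3 ^ (1 + 1) = 9 by norm_num]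
      exact (kubertTate_nine_nsmul_zero_iff r s h₀ hr hr₁ hs).mpr hF
    have h3 : ¬ 3 ^ 1 • P₀ = 0 := by
      rw [pow_one, hP₀, e3]
      exact Affine.Point.some_ne_zero _
    rw [addOrderOf_eq_prime_pow h3 h9]
    norm_num

/-- **`(r, s)` chart, exact-order form**: on `E(rs(r-1), s(r-1))` with `(0, 0)` nonsingular, `(0, 0)` has order `9`
iff `r = s² - s + 1`. [cite: Sutherland2012, §2 (raw form of X₁(N)), N = 9] -/
theorem kubertTate_addOrderOf_zero_eq_nine_iff_raw
    (h₀ : (kubertTate (r * s * (r - 1)) (s * (r - 1))).toAffine.Nonsingular 0 0) :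
    addOrderOf (Affine.Point.some 0 0 h₀ : (kubertTate (r * s * (r - 1)) (s * (r - 1))).toAffine.Point)
      = 9 ↔ r = s ^ 2 - s + 1 := by
  have hb : r * s * (r - 1) ≠ 0 := (kubertTate_nonsingular_zero_iff _ _).mp h₀
  have hs : s ≠ 0 := right_ne_zero_of_mul (left_ne_zero_of_mul hb)
  have hr₁' : r - 1 ≠ 0 := right_ne_zero_of_mul hb
  rw [kubertTate_addOrderOf_zero_eq_nine_iff, kubertTateX₉_eq_mul_raw, mul_eq_zero,
    or_iff_right (mul_ne_zero (pow_ne_zero 3 hs) (pow_ne_zero 5 hr₁'))]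
  constructor
  · intro h; linear_combination h
  · intro h; linear_combination h

omit [DecidableEq F] in
/-- On Kubert's family `E₉(f) = E(f²(f-1)(f²-f+1), f²(f-1))` the marked point `(0, 0)` is nonsingular iff
`f ∉ {0, 1}` and `f² - f + 1 ≠ 0` (i.e. `b ≠ 0`). [cite: Kubert1976, Table 3 (N = 9)] -/
theorem kubertTate_nine_family_nonsingular_zero_iff (f : F) :
    (kubertTate (f ^ 2 * (f - 1) * (f ^ 2 - f + 1)) (f ^ 2 * (f - 1))).toAffine.Nonsingular 0 0 ↔
      f ≠ 0 ∧ f ≠ 1 ∧ f ^ 2 - f + 1 ≠ 0 := by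
  rw [kubertTate_nonsingular_zero_iff]
  refine ⟨fun h ↦ ⟨?_, ?_, ?_⟩, fun ⟨h0, h1, h2⟩ ↦ ?_⟩
  · rintro rfl; apply h; ring
  · rintro rfl; apply h; ring
  · intro h2; apply h; rw [h2]; ring
  · exact mul_ne_zero (mul_ne_zero (pow_ne_zero 2 h0) (sub_ne_zero.mpr h1)) h2

/-- **On Kubert's family the marked point has order EXACTLY `9`**: for `f ∉ {0, 1}`, `f² - f + 1 ≠ 0`,
`addOrderOf (0, 0) = 9` on `E(f²(f-1)(f²-f+1), f²(f-1))` (any field; `Δ` may vanish).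
[cite: Kubert1976, Table 3 (N = 9)] [cite: Knapp1993, §V.5 pp. 146–147] -/
theorem kubertTate_nine_family_addOrderOf_eq_nine (f : F)
    (h₀ : (kubertTate (f ^ 2 * (f - 1) * (f ^ 2 - f + 1)) (f ^ 2 * (f - 1))).toAffine.Nonsingular 0 0) :
    addOrderOf (Affine.Point.some 0 0 h₀ :
      (kubertTate (f ^ 2 * (f - 1) * (f ^ 2 - f + 1)) (f ^ 2 * (f - 1))).toAffine.Point) = 9 :=
  (kubertTate_addOrderOf_zero_eq_nine_iff _ _ h₀).mpr (kubertTateX₉_nine_family f)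

/-- **A Tate normal form with `(0, 0)` of order `9` IS a member of Kubert's family**: `b = f²(f-1)(f²-f+1)`,
`c = f²(f-1)` with `f = s = c²/(b - c) ∉ {0, 1}` (from `r = s² - s + 1`: `c = s(r - 1) = s²(s - 1)`,
`b = rs(r - 1)`). [cite: Kubert1976, Table 3 (N = 9)] [cite: Sutherland2012, §2] -/
theorem exists_kubertTate_nine_of_kubertTate_addOrderOf_eq_nine {b c : F}
    (h₀ : (kubertTate b c).toAffine.Nonsingular 0 0)
    (h9 : addOrderOf (Affine.Point.some 0 0 h₀ : (kubertTate b c).toAffine.Point) = 9) :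
    ∃ f : F, f ≠ 0 ∧ f ≠ 1 ∧ b = f ^ 2 * (f - 1) * (f ^ 2 - f + 1) ∧ c = f ^ 2 * (f - 1) := by
  have hb : b ≠ 0 := (kubertTate_nonsingular_zero_iff b c).mp h₀
  have hX := (kubertTate_addOrderOf_zero_eq_nine_iff b c h₀).mp h9
  have hc : c ≠ 0 := by
    intro hc
    rw [hc, kubertTateX₉_zero_right] at hX
    exact hb (pow_eq_zero_iff (n := 3) (by norm_num) |>.mp hX)
  have hbc : b - c ≠ 0 := by
    intro hbc
    rw [(sub_eq_zero.mp hbc).symm, kubertTateX₉_self_self, neg_eq_zero] at hX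
    exact hb (pow_eq_zero_iff (n := 5) (by norm_num) |>.mp hX)
  obtain ⟨r, s, rfl, rfl⟩ := exists_kubertTate_param b c hc hbc
  have hs : s ≠ 0 := left_ne_zero_of_mul hc
  have hr₁' : r - 1 ≠ 0 := right_ne_zero_of_mul hc
  have hr₁ : r ≠ 1 := sub_ne_zero.mp hr₁'
  rw [kubertTateX₉_eq_mul_raw] at hX
  have hF : r = s ^ 2 - s + 1 := by
    rcases mul_eq_zero.mp hX with h | h
    · exact absurd h (mul_ne_zero (pow_ne_zero 3 hs) (pow_ne_zero 5 hr₁'))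
    · linear_combination h
  refine ⟨s, hs, ?_, ?_, ?_⟩
  · rintro rfl
    apply hr₁
    rw [hF]; ring
  · rw [hF]; ring
  · rw [hF]; ring

/-- **Every Weierstrass curve with a nonsingular point of order `9` is Kubert's `E₉(f)` up to an admissible change
of variables** (over any field `F`): `∃ f ∉ {0, 1}`, `f² - f + 1 ≠ 0`, `∃ C`, `C • W = E(f²(f-1)(f²-f+1), f²(f-1))`.
Proof: `P, 2P, 3P ≠ 𝒪`, so the Tate normal form (`exists_variableChange_pointEquiv_eq_zero`) gives `C • W = E(b, c)`
with `P ↦ (0, 0)` of order `9` (`AddEquiv.addOrderOf_eq`); conclude by the previous theorem (`f² - f + 1 ≠ 0` from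
`b ≠ 0`). No ellipticity hypothesis. [cite: Kubert1976, Table 3 (N = 9)] [cite: Knapp1993, §V.5 pp. 146–147] -/
theorem exists_kubertTate_nine_of_addOrderOf_eq_nine (W : WeierstrassCurve F)
    {P : W.toAffine.Point} (hP : addOrderOf P = 9) :
    ∃ f : F, f ≠ 0 ∧ f ≠ 1 ∧ f ^ 2 - f + 1 ≠ 0 ∧
      ∃ C : VariableChange F, C • W = kubertTate (f ^ 2 * (f - 1) * (f ^ 2 - f + 1)) (f ^ 2 * (f - 1)) := by
  rcases P with _ | ⟨x, y, hxy⟩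
  · rw [← Affine.Point.zero_def, addOrderOf_zero] at hP
    omega
  · have h2 : 2 • Affine.Point.some x y hxy ≠ 0 := fun h0 => by
      have hdvd := Nat.le_of_dvd two_pos (addOrderOf_dvd_of_nsmul_eq_zero h0)
      rw [hP] at hdvd
      omega
    have h3 : 3 • Affine.Point.some x y hxy ≠ 0 := fun h0 => by
      have hdvd := Nat.le_of_dvd three_pos (addOrderOf_dvd_of_nsmul_eq_zero h0)
      rw [hP] at hdvd
      omega
    obtain ⟨b, c, C, hC, h₀, he⟩ := exists_variableChange_pointEquiv_eq_zero W hxy h2 h3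
    have h9 : addOrderOf (Affine.Point.some 0 0 h₀ : (kubertTate b c).toAffine.Point) = 9 := by
      rw [← he, AddEquiv.addOrderOf_eq, AddEquiv.addOrderOf_eq, hP]
    obtain ⟨f, hf0, hf1, hb, hc⟩ := exists_kubertTate_nine_of_kubertTate_addOrderOf_eq_nine h₀ h9
    have hb0 : b ≠ 0 := (kubertTate_nonsingular_zero_iff b c).mp h₀
    refine ⟨f, hf0, hf1, ?_, C, ?_⟩
    · intro h2
      apply hb0
      rw [hb, h2]; ring
    · rw [hC, hb, hc]

/-- **`W` has an `F`-rational (nonsingular) point of order `9` ⟺ `W ≅ E₉(f)` for some `f ∈ F` with `f ∉ {0,1}`,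
`f² - f + 1 ≠ 0`** — the universal property of `X₁(9) ≅ ℙ¹` in Tate normal form (`⟸`: pull the marked point
back along `VariableChange.pointEquiv` / `Affine.Point.congrEquiv`). [cite: Kubert1976, Table 3 (N = 9)]
[cite: Knapp1993, §V.5 pp. 146–147] -/
theorem exists_addOrderOf_eq_nine_iff_exists_kubertTate_nine (W : WeierstrassCurve F) :
    (∃ P : W.toAffine.Point, addOrderOf P = 9) ↔
      ∃ f : F, f ≠ 0 ∧ f ≠ 1 ∧ f ^ 2 - f + 1 ≠ 0 ∧
        ∃ C : VariableChange F, C • W = kubertTate (f ^ 2 * (f - 1) * (f ^ 2 - f + 1)) (f ^ 2 * (f - 1)) := by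
  constructor
  · rintro ⟨P, hP⟩
    exact exists_kubertTate_nine_of_addOrderOf_eq_nine W hP
  · rintro ⟨f, hf0, hf1, hf2, C, hC⟩
    have h₀ := (kubertTate_nine_family_nonsingular_zero_iff f).mpr ⟨hf0, hf1, hf2⟩
    have h9 := kubertTate_nine_family_addOrderOf_eq_nine f h₀
    -- pull the marked point back along the change of variables
    set Q : (C • W).toAffine.Point := (Affine.Point.congrEquiv hC).symm (Affine.Point.some 0 0 h₀)
      with hQ
    refine ⟨(VariableChange.pointEquiv W C).symm Q, ?_⟩
    rw [AddEquiv.addOrderOf_eq, hQ, AddEquiv.addOrderOf_eq, h9]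

end Field

end WeierstrassCurve

end
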